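import Summits.Ventures.PercRepro.Night2FatXTwoLines
import Summits.Ventures.PercRepro.Night2FatXLinePointNumeric
import Summits.Ventures.PercRepro.Night2FatXCollinear

/-!
# night-2: generic off-points close the fat case for `|G| ≥ 14`

With generic off-points (no three-point line of `V` coplanar with `w₀, x`) every load above `Q ∪ {x}` is at distance
one: `Y = T ∖ Q ∖ {x}` lies on a basis line.  For `N = |G ∖ Q| ≥ 8` three cases close the fair share of a lossy basis
pair: a point of `W ∖ {x}` off every basis line is a free point (`basis_pair_fair_fat_of_free_point_generic`); all of
`W ∖ {x}` on one basis line is the nested extreme (`basis_pair_fair_fat_of_collinear_of_generic`); otherwise two basis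
lines carry points of `W ∖ {x}`, the lighter one `ℓ_ab ∋ y₁` carries `t₁ ≤ m/2` of the `m = N − 1` points, and the
targets through `x, y₁` not inside `ℓ_ab` — at least `C(m − 1, j − 2) − C(t₁ − 1, j − 2)` at level `j`
(`fat_count_level_ge_line_point`) — are unloaded: the levels `1, 3, …, 7` give
`(110/221)(1 + 4/15 + 14/35 + 20/70 + 15/126 + 6/210) = 1.045` (`fat_count_numeric_line_point`, using
`C(m − 1, i) − C(t₁ − 1, i) ≥ C(6, i) − C(2, i)` for `t₁ + 4 ≤ m`, `choose_add_le_choose_add_four`).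
**`basis_pair_fair_fat_of_generic_of_eight_le`** and **`localShadowHall_fat_of_generic_of_fourteen_le`**: the (2,1)
cell with a fat closure and generic off-points satisfies the local Hall inequality for every `|G| ≥ 14` — with
`localShadowHall_fat_of_generic_of_card_le_eleven` only `|G| ∈ {12, 13}` remain under genericity.
Paper `proofs/NIGHT-2-g33.md` §6 (d).
-/

namespace PercRepro.Shadow

open PercRepro.ThmH PercRepro.PerFlat

variable {α : Type*} [DecidableEq α] {M : Matroid α} [M.Finite] {G : Finset α}

/-- **The unloaded targets through `x` and a point `y₁` of the basis line `ℓ_ab` at level `j ≥ 2`** number at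
least `C(N − 2, j − 2) − C(t₁ − 1, j − 2)` (`t₁ = |W ∖ {x} ∩ ℓ_ab|`), each worth `fatTerm j (11/18)`. -/
theorem fat_count_level_ge_line_point (hG : G ∈ flatsQ M (5 + 1)) (hd : (gr M \ G).card = 2)
    (hk : kColoops M G = 1) (hs : ∀ e ∈ gr M, ∀ f ∈ gr M, e ≠ f → rkN M {e, f} = 2)
    (hl : ∀ e ∈ gr M, M.Indep {e}) (hfat : (fatClosures M 5 G 2).card ≤ 1) {B₀ : Finset α}
    (hB₀ : B₀ ∈ thinMembers M 5 G) {w₀ x : α} (hD : G \ clF M B₀ = {w₀, x})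
    (hgen : ∀ R ⊆ G \ coloops M G, rkN M R = 2 → 3 ≤ R.card → 4 ≤ rkN M (insert w₀ (insert x R)))
    {B : Finset α} (hB : B ∈ thinMembers M 5 G) (hnP : ¬ bigP M G B) {z : α} (hz : z ∈ G \ clF M B)
    (hx : x ∈ G \ insert z B) {y₁ : α} (hy₁ : y₁ ∈ (G \ insert z B).erase x) {a b : α}
    (ha : a ∈ (insert z B \ coloops M G).erase w₀) (hb : b ∈ (insert z B \ coloops M G).erase w₀) (hab : a ≠ b)
    (hline : rkN M {a, b, y₁} ≤ 2) {j : ℕ} (hj : 2 ≤ j) :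
    ((((G \ insert z B).card - 2).choose (j - 2) -
      ((((G \ insert z B).erase x).filter (fun y => rkN M (insert y {a, b}) ≤ 2)).erase y₁).card.choose (j - 2) : ℕ) : ℚ) *
      fatTerm j (11 / 18) ≤
      ∑ T ∈ ((tgtSets M 5 G B z).filter
        (fun T => x ∈ T ∧ dload M 5 G (bigP M G) (dshGT2 M 5 G) T = 0)).filter
        (fun T => (T \ insert z B).card = j),
        capS M 5 G T / ((221 / 360 : ℚ) * ((2 * ((T \ coloops M G).card - 2).choose 4 : ℕ) : ℚ)) := by
  have hd' : (gr M \ G).card ≤ 5 := by omega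
  have hy₁x : y₁ ≠ x := (Finset.mem_erase.1 hy₁).1
  have hX : ({x, y₁} : Finset α) ⊆ G \ insert z B := by
    intro e he
    rw [Finset.mem_insert, Finset.mem_singleton] at he
    rcases he with rfl | rfl
    · exact hx
    · exact Finset.mem_of_mem_erase hy₁
  have hX2 : ({x, y₁} : Finset α).card = 2 := Finset.card_pair hy₁x.symm
  have hcount := choose_le_card_targets_level hG hB hz hX (by omega : 1 ≤ j) (by rw [hX2]; exact hj)
  rw [hX2] at hcount
  set A := (tgtSets M 5 G B z).filter (fun T => ({x, y₁} : Finset α) ⊆ T ∧ (T \ insert z B).card = j) with hA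
  have hsplit := Finset.card_filter_add_card_filter_not
    (s := A) (fun T => dload M 5 G (bigP M G) (dshGT2 M 5 G) T = 0)
  have hloaded := card_loaded_targets_through_le hG hd hk hs hl hfat hB₀ hD hgen hB hnP hz
    (Finset.mem_sdiff.1 hx).2 hy₁ ha hb hab hline j
  have hloadsub : A.filter (fun T => ¬ dload M 5 G (bigP M G) (dshGT2 M 5 G) T = 0) ⊆
      (tgtSets M 5 G B z).filter (fun T => ({x, y₁} : Finset α) ⊆ T ∧ (T \ insert z B).card = j ∧
        dload M 5 G (bigP M G) (dshGT2 M 5 G) T ≠ 0) := by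
    intro T hT
    rw [Finset.mem_filter, hA, Finset.mem_filter] at hT
    rw [Finset.mem_filter]
    exact ⟨hT.1.1, hT.1.2.1, hT.1.2.2, hT.2⟩
  have hl' := le_trans (Finset.card_le_card hloadsub) hloaded
  set F := ((tgtSets M 5 G B z).filter
    (fun T => x ∈ T ∧ dload M 5 G (bigP M G) (dshGT2 M 5 G) T = 0)).filter
    (fun T => (T \ insert z B).card = j) with hF
  have hsub : A.filter (fun T => dload M 5 G (bigP M G) (dshGT2 M 5 G) T = 0) ⊆ F := by
    intro T hT
    rw [Finset.mem_filter, hA, Finset.mem_filter] at hT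
    rw [hF, Finset.mem_filter, Finset.mem_filter]
    exact ⟨⟨hT.1.1, hT.1.2.1 (Finset.mem_insert_self _ _), hT.2⟩, hT.1.2.2⟩
  have hcardU : (((G \ insert z B).card - 2).choose (j - 2) -
      ((((G \ insert z B).erase x).filter (fun y => rkN M (insert y {a, b}) ≤ 2)).erase y₁).card.choose (j - 2) : ℕ) ≤
      (A.filter (fun T => dload M 5 G (bigP M G) (dshGT2 M 5 G) T = 0)).card := by
    omega
  have hterm : ∀ T ∈ F, fatTerm j (11 / 18) ≤
      capS M 5 G T / ((221 / 360 : ℚ) * ((2 * ((T \ coloops M G).card - 2).choose 4 : ℕ) : ℚ)) := by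
    intro T hT
    rw [hF, Finset.mem_filter, Finset.mem_filter] at hT
    obtain ⟨⟨hTt, -, -⟩, hTj⟩ := hT
    have hTG : T ⊆ G := subset_G_of_mem_shadowAt (mem_tgtSets.1 hTt).1
    have hTK : (T \ coloops M G).card = j + 5 := by
      rw [card_sdiff_coloops_eq_level_add_five hG hd hk hB hnP hz hTt, hTj]
    unfold fatTerm
    rw [hTK, show j + 5 - 2 = j + 3 by omega]
    apply div_le_div_of_nonneg_right (capS_ge_eleven_eighteenths_two_one hd hk hTG)
    positivity
  have hpos : 0 ≤ fatTerm j (11 / 18) := by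
    unfold fatTerm
    positivity
  calc ((((G \ insert z B).card - 2).choose (j - 2) -
        ((((G \ insert z B).erase x).filter (fun y => rkN M (insert y {a, b}) ≤ 2)).erase y₁).card.choose (j - 2) : ℕ) : ℚ) *
        fatTerm j (11 / 18)
      ≤ ((A.filter (fun T => dload M 5 G (bigP M G) (dshGT2 M 5 G) T = 0)).card : ℚ) * fatTerm j (11 / 18) := by
        apply mul_le_mul_of_nonneg_right _ hpos
        exact_mod_cast hcardU
    _ = ∑ _T ∈ A.filter (fun T => dload M 5 G (bigP M G) (dshGT2 M 5 G) T = 0), fatTerm j (11 / 18) := by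
        rw [Finset.sum_const, nsmul_eq_mul]
    _ ≤ ∑ T ∈ A.filter (fun T => dload M 5 G (bigP M G) (dshGT2 M 5 G) T = 0),
        capS M 5 G T / ((221 / 360 : ℚ) * ((2 * ((T \ coloops M G).card - 2).choose 4 : ℕ) : ℚ)) :=
        Finset.sum_le_sum (fun T hT => hterm T (hsub hT))
    _ ≤ _ := by
        apply Finset.sum_le_sum_of_subset_of_nonneg hsub
        intro T _ _
        exact div_nonneg (capS_nonneg' hG hd' T) (by positivity)


/-- **The fat case of (FAIR) with generic off-points from a point of a light basis line**: `y₁ ∈ W ∖ {x}` on the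
basis line `ℓ_ab` carrying at most half of the points of `W ∖ {x}`, `N ≥ 8`. -/
theorem basis_pair_fair_fat_of_generic_of_line_point (hG : G ∈ flatsQ M (5 + 1)) (hd : (gr M \ G).card = 2)
    (hk : kColoops M G = 1) (hs : ∀ e ∈ gr M, ∀ f ∈ gr M, e ≠ f → rkN M {e, f} = 2)
    (hl : ∀ e ∈ gr M, M.Indep {e}) (hfat : (fatClosures M 5 G 2).card ≤ 1)
    {B₀ : Finset α} (hB₀ : B₀ ∈ thinMembers M 5 G) {w₀ x : α} (hD : G \ clF M B₀ = {w₀, x}) (hne : w₀ ≠ x)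
    (hgen : ∀ R ⊆ G \ coloops M G, rkN M R = 2 → 3 ≤ R.card → 4 ≤ rkN M (insert w₀ (insert x R)))
    {B : Finset α} (hB : B ∈ thinMembers M 5 G) (hnP : ¬ bigP M G B) {z : α} (hz : z ∈ G \ clF M B)
    (hl0 : loss M 5 G B z ≠ 0) (hw₀ : w₀ ∈ insert z B) (hx : x ∉ insert z B) (hN : 8 ≤ (G \ insert z B).card)
    {y₁ : α} (hy₁ : y₁ ∈ (G \ insert z B).erase x) {a b : α}
    (ha : a ∈ (insert z B \ coloops M G).erase w₀) (hb : b ∈ (insert z B \ coloops M G).erase w₀) (hab : a ≠ b)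
    (hline : rkN M {a, b, y₁} ≤ 2)
    (ht : 2 * (((G \ insert z B).erase x).filter (fun y => rkN M (insert y {a, b}) ≤ 2)).card ≤
      ((G \ insert z B).erase x).card) :
    loss M 5 G B z ≤ rhoL M 5 G B z * lossIncomeH M 5 G (bigP M G) (dshGT2 M 5 G) B z := by
  have hd' : (gr M \ G).card ≤ 5 := by omega
  have hxG : x ∈ G \ insert z B := by
    refine Finset.mem_sdiff.2 ⟨?_, hx⟩
    have : x ∈ G \ clF M B₀ := by
      rw [hD]
      exact Finset.mem_insert_of_mem (Finset.mem_singleton_self _)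
    exact (Finset.mem_sdiff.1 this).1
  set L := ((G \ insert z B).erase x).filter (fun y => rkN M (insert y {a, b}) ≤ 2) with hL
  have hy₁L : y₁ ∈ L := by
    rw [hL, Finset.mem_filter, insert_pair_eq']
    exact ⟨hy₁, hline⟩
  have hLcard : (L.erase y₁).card + 1 = L.card := by
    rw [Finset.card_erase_of_mem hy₁L]
    have : 0 < L.card := Finset.card_pos.2 ⟨y₁, hy₁L⟩
    omega
  have hm : ((G \ insert z B).erase x).card + 1 = (G \ insert z B).card := by
    rw [Finset.card_erase_of_mem hxG]
    have : 0 < (G \ insert z B).card := by omega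
    omega
  apply basis_pair_fair_of_fat_count_sum hG hd hk hs hl hfat hB₀ hD hne hB hnP hz hl0 hw₀ hx
  have hg0 : ∀ T ∈ (tgtSets M 5 G B z).filter
      (fun T => x ∈ T ∧ dload M 5 G (bigP M G) (dshGT2 M 5 G) T = 0),
      0 ≤ capS M 5 G T / ((221 / 360 : ℚ) * ((2 * ((T \ coloops M G).card - 2).choose 4 : ℕ) : ℚ)) :=
    fun T _ => div_nonneg (capS_nonneg' hG hd' T) (by positivity)
  have hsum := sum_levels_le_sum hg0 (fun T => (T \ insert z B).card) {1, 3, 4, 5, 6, 7}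
  rw [Finset.sum_insert (by decide), Finset.sum_insert (by decide), Finset.sum_insert (by decide),
    Finset.sum_insert (by decide), Finset.sum_insert (by decide), Finset.sum_singleton] at hsum
  have hl1 := fat_count_level_ge' hG hd hk hB hnP hz hxG (j := 1) (by norm_num)
    (fun T hT _ h1 => dload_eq_zero_of_card_sdiff_le_six hG hd hk hs hl
      (by rw [card_sdiff_coloops_eq_level_add_five hG hd hk hB hnP hz hT, h1]))
  have hl3 := fat_count_level_ge_line_point hG hd hk hs hl hfat hB₀ hD hgen hB hnP hz hxG hy₁ ha hb hab hline
    (j := 3) (by norm_num)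
  have hl4 := fat_count_level_ge_line_point hG hd hk hs hl hfat hB₀ hD hgen hB hnP hz hxG hy₁ ha hb hab hline
    (j := 4) (by norm_num)
  have hl5 := fat_count_level_ge_line_point hG hd hk hs hl hfat hB₀ hD hgen hB hnP hz hxG hy₁ ha hb hab hline
    (j := 5) (by norm_num)
  have hl6 := fat_count_level_ge_line_point hG hd hk hs hl hfat hB₀ hD hgen hB hnP hz hxG hy₁ ha hb hab hline
    (j := 6) (by norm_num)
  have hl7 := fat_count_level_ge_line_point hG hd hk hs hl hfat hB₀ hD hgen hB hnP hz hxG hy₁ ha hb hab hline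
    (j := 7) (by norm_num)
  rw [← hL] at hl3 hl4 hl5 hl6 hl7
  have hnum := fat_count_numeric_line_point ((G \ insert z B).card - 2) (L.erase y₁).card (by omega) (by omega)
  have hc1 : (if (G \ insert z B).card - 1 ≤ 3 then (1 : ℚ) else 11 / 18) = 11 / 18 := by
    rw [if_neg (by omega)]
  rw [hc1] at hl1
  simp only [Nat.sub_self, Nat.choose_zero_right, Nat.cast_one, one_mul] at hl1
  linarith


/-- **The fat case of (FAIR) with generic off-points for `N ≥ 8`**: a free point, or all of `W ∖ {x}` on one basis
line, or a point of the lighter of two basis lines. -/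
theorem basis_pair_fair_fat_of_generic_of_eight_le (hG : G ∈ flatsQ M (5 + 1)) (hd : (gr M \ G).card = 2)
    (hk : kColoops M G = 1) (hs : ∀ e ∈ gr M, ∀ f ∈ gr M, e ≠ f → rkN M {e, f} = 2)
    (hl : ∀ e ∈ gr M, M.Indep {e}) (hfat : (fatClosures M 5 G 2).card ≤ 1)
    {B₀ : Finset α} (hB₀ : B₀ ∈ thinMembers M 5 G) {w₀ x : α} (hD : G \ clF M B₀ = {w₀, x}) (hne : w₀ ≠ x)
    (hgen : ∀ R ⊆ G \ coloops M G, rkN M R = 2 → 3 ≤ R.card → 4 ≤ rkN M (insert w₀ (insert x R)))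
    {B : Finset α} (hB : B ∈ thinMembers M 5 G) (hnP : ¬ bigP M G B) {z : α} (hz : z ∈ G \ clF M B)
    (hl0 : loss M 5 G B z ≠ 0) (hw₀ : w₀ ∈ insert z B) (hx : x ∉ insert z B) (hN : 8 ≤ (G \ insert z B).card) :
    loss M 5 G B z ≤ rhoL M 5 G B z * lossIncomeH M 5 G (bigP M G) (dshGT2 M 5 G) B z := by
  have hGg : G ⊆ gr M := (mem_flatsQ.1 hG).1
  have hQG : insert z B ⊆ G :=
    Finset.insert_subset (Finset.mem_sdiff.1 hz).1 (subset_G_of_mem_thinMembers hB)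
  have hxG : x ∈ G \ insert z B := by
    refine Finset.mem_sdiff.2 ⟨?_, hx⟩
    have : x ∈ G \ clF M B₀ := by
      rw [hD]
      exact Finset.mem_insert_of_mem (Finset.mem_singleton_self _)
    exact (Finset.mem_sdiff.1 this).1
  set W' := (G \ insert z B).erase x with hW'
  have hm : W'.card + 1 = (G \ insert z B).card := by
    rw [hW', Finset.card_erase_of_mem hxG]
    have : 0 < (G \ insert z B).card := by omega
    omega
  -- a point of `W ∖ {x}` lies on a basis line, or is free
  by_cases hfree : ∃ y ∈ W', ∀ a ∈ (insert z B \ coloops M G).erase w₀,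
      ∀ b ∈ (insert z B \ coloops M G).erase w₀, a ≠ b → rkN M {a, b, y} = 3
  · obtain ⟨y, hy, hfr⟩ := hfree
    exact basis_pair_fair_fat_of_free_point_generic hG hd hk hs hl hfat hB₀ hD hne hgen hB hnP hz hl0 hw₀ hx
      (Finset.mem_of_mem_erase hy) (fun h' => (Finset.mem_erase.1 hy).1 h'.symm) hN hfr
  · -- every point of `W ∖ {x}` lies on a basis line
    have hall : ∀ y ∈ W', ∃ a ∈ (insert z B \ coloops M G).erase w₀, ∃ b ∈ (insert z B \ coloops M G).erase w₀,
        a ≠ b ∧ rkN M {a, b, y} ≤ 2 := by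
      intro y hy
      by_contra hcon
      apply hfree
      refine ⟨y, hy, ?_⟩
      intro a ha b hb hab
      have h3 : rkN M {a, b, y} ≤ 3 := le_trans (rkN_le_card _) Finset.card_le_three
      by_contra hne3
      exact hcon ⟨a, ha, b, hb, hab, by omega⟩
    obtain ⟨y₀, hy₀⟩ : W'.Nonempty := by
      rw [← Finset.card_pos]
      omega
    obtain ⟨a₀, ha₀, b₀, hb₀, hab₀, hl₀⟩ := hall y₀ hy₀
    set L₀ := W'.filter (fun y => rkN M (insert y {a₀, b₀}) ≤ 2) with hL₀
    have hy₀L : y₀ ∈ L₀ := by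
      rw [hL₀, Finset.mem_filter, insert_pair_eq']
      exact ⟨hy₀, hl₀⟩
    by_cases hcol : ∀ y ∈ W', rkN M (insert y {a₀, b₀}) ≤ 2
    · -- all of `W ∖ {x}` on the basis line `a₀ b₀`: the nested extreme
      have ha₀G : a₀ ∈ G := hQG (Finset.mem_sdiff.1 (Finset.mem_of_mem_erase ha₀)).1
      have hb₀G : b₀ ∈ G := hQG (Finset.mem_sdiff.1 (Finset.mem_of_mem_erase hb₀)).1
      have hpair : ({a₀, b₀} : Finset α) ⊆ gr M := by
        intro e he
        rw [Finset.mem_insert, Finset.mem_singleton] at he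
        rcases he with rfl | rfl
        · exact hGg ha₀G
        · exact hGg hb₀G
      have hsub : W' ⊆ clF M {a₀, b₀} := by
        intro y hy
        have h' := hcol y hy
        rw [insert_pair_eq'] at h'
        exact mem_clF_pair_of_rkN_le_two hG hs ha₀G hb₀G (Finset.mem_sdiff.1 (Finset.mem_of_mem_erase hy)).1
          hab₀.symm h'
      have hrk : rkN M W' ≤ 2 := by
        have := rkN_mono (M := M) hsub
        rw [rkN_clF, hs a₀ (hGg ha₀G) b₀ (hGg hb₀G) hab₀] at this
        exact this
      exact basis_pair_fair_fat_of_collinear_of_generic hG hd hk hs hl hfat hB₀ hD hne hgen hB hnP hz hl0 hw₀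
        hx hrk
    · -- a second basis line: the lighter of the two carries at most half of `W ∖ {x}`
      obtain ⟨y', hy'W, hy'L⟩ : ∃ y' ∈ W', ¬ rkN M (insert y' {a₀, b₀}) ≤ 2 := by
        by_contra hcon
        apply hcol
        intro y hy
        by_contra h'
        exact hcon ⟨y, hy, h'⟩
      obtain ⟨a', ha', b', hb', hab', hl'⟩ := hall y' hy'W
      set L' := W'.filter (fun y => rkN M (insert y {a', b'}) ≤ 2) with hL'
      have hy'L' : y' ∈ L' := by
        rw [hL', Finset.mem_filter, insert_pair_eq']
        exact ⟨hy'W, hl'⟩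
      have hpairs : ({a₀, b₀} : Finset α) ≠ {a', b'} := by
        intro heq
        apply hy'L
        rw [heq, insert_pair_eq']
        exact hl'
      have hdisj : Disjoint L₀ L' := by
        rw [Finset.disjoint_left]
        intro y hyL₀ hyL'
        rw [hL₀, Finset.mem_filter, insert_pair_eq'] at hyL₀
        rw [hL', Finset.mem_filter, insert_pair_eq'] at hyL'
        exact not_on_two_basis_lines hG hd hk hs hl hB hnP hz (Finset.mem_of_mem_erase ha₀)
          (Finset.mem_of_mem_erase hb₀) (Finset.mem_of_mem_erase ha') (Finset.mem_of_mem_erase hb') hab₀ hab'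
          hpairs (Finset.mem_of_mem_erase hyL₀.1) hyL₀.2 hyL'.2
      have hcards : L₀.card + L'.card ≤ W'.card := by
        rw [← Finset.card_union_of_disjoint hdisj]
        exact Finset.card_le_card (Finset.union_subset (Finset.filter_subset _ _) (Finset.filter_subset _ _))
      rcases Nat.lt_or_ge (2 * L₀.card) (W'.card + 1) with h₀ | h₀
      · exact basis_pair_fair_fat_of_generic_of_line_point hG hd hk hs hl hfat hB₀ hD hne hgen hB hnP hz hl0
          hw₀ hx hN hy₀ ha₀ hb₀ hab₀ hl₀ (by rw [← hW', ← hL₀]; omega)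
      · exact basis_pair_fair_fat_of_generic_of_line_point hG hd hk hs hl hfat hB₀ hD hne hgen hB hnP hz hl0
          hw₀ hx hN hy'W ha' hb' hab' hl' (by rw [← hW', ← hL']; omega)

/-- **The (2,1) cell with a fat closure and generic off-points, `|G| ≥ 14`.** -/
theorem localShadowHall_fat_of_generic_of_fourteen_le (hG : G ∈ flatsQ M (5 + 1)) (hd : (gr M \ G).card = 2)
    (hk : kColoops M G = 1) (hs : ∀ e ∈ gr M, ∀ f ∈ gr M, e ≠ f → rkN M {e, f} = 2)
    (hl : ∀ e ∈ gr M, M.Indep {e}) (hfat : (fatClosures M 5 G 2).card ≤ 1)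
    {B₀ : Finset α} (hB₀ : B₀ ∈ thinMembers M 5 G) (hm₀ : (G \ clF M B₀).card = 2)
    (hgen : ∀ R ⊆ G \ coloops M G, rkN M R = 2 → 3 ≤ R.card → 4 ≤ rkN M (R ∪ (G \ clF M B₀)))
    (hG14 : 14 ≤ G.card) : LocalShadowHall M 5 G := by
  apply localShadowHall_of_gt2_of_basis_fair hG hd hk hs hl hfat
  intro B hB hnP z hz
  have hd' : (gr M \ G).card ≤ 5 := by omega
  by_cases hl0 : loss M 5 G B z = 0
  · rw [hl0]
    have h1 : 0 ≤ rhoL M 5 G B z := by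
      unfold rhoL
      rw [hl0]
      simp
    have h2 : 0 ≤ lossIncomeH M 5 G (bigP M G) (dshGT2 M 5 G) B z :=
      lossIncomeH_nonneg hG hd' (column_side_gt2 hG hd hk hs hl hfat) B z
    positivity
  · obtain ⟨w₀, x, hD, hne, hw₀, hx⟩ := exists_fat_split hG hd hk hB₀ hm₀ hB hz hl0
    have hgen' : ∀ R ⊆ G \ coloops M G, rkN M R = 2 → 3 ≤ R.card → 4 ≤ rkN M (insert w₀ (insert x R)) := by
      intro R hR hR2 hR3
      have := hgen R hR hR2 hR3
      rw [hD] at this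
      have heq : R ∪ ({w₀, x} : Finset α) = insert w₀ (insert x R) := by
        ext e
        simp only [Finset.mem_union, Finset.mem_insert, Finset.mem_singleton]
        tauto
      rw [heq] at this
      exact this
    have hN : 8 ≤ (G \ insert z B).card := by
      have hQG : insert z B ⊆ G :=
        Finset.insert_subset (Finset.mem_sdiff.1 hz).1 (subset_G_of_mem_thinMembers hB)
      have hKQ : coloops M G ⊆ insert z B :=
        (coloops_subset_of_mem_thinMembers hG hd' hB).trans (Finset.subset_insert _ _)
      have hQ5 := card_insert_sdiff_eq_five hG hd hk hB hnP hz
      have h1 := Finset.card_sdiff_add_card_eq_card hKQ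
      rw [← kColoops_eq_card_coloops, hk, hQ5] at h1
      have h2 := Finset.card_sdiff_add_card_eq_card hQG
      omega
    exact basis_pair_fair_fat_of_generic_of_eight_le hG hd hk hs hl hfat hB₀ hD hne hgen' hB hnP hz hl0 hw₀ hx hN

end PercRepro.Shadow
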